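import Summits.QuantumFields.QCD.Theorems.QuarksAsStableActionUnquenchedChessboardBoundStubAxisSwap
import Summits.QuantumFields.QCD.Theorems.QuarksAsStableActionWilsonQuarkStabilityStubStaticIterate
import Literature.MathematicalPhysics.QuantumLattice.WilsonDiracAP

/-!
# Four-axis iteration of the static slice bound, all colour numbers `N`
(stub `stub_staticIterateAllN` of crux stmt-QuantumFields-9307, line `registered`)

This is the port of the stub `stub_staticIterate` of crux stmt-QuantumFields-9736
(`Cruxes.WilsonQuarkStability.FreeTangentLandauChessboard.stub_staticIterate`) from the colour
group `U(3)` to `U(N)`: the colour index type `Fin 3` becomes `Fin N`, everything else (the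
four-torus `(ℤ/L)⁴`, the directions `Fin 4`) is unchanged.

Write `D[V] = ‖det D_W[V, m]‖` for the `r = 1` Wilson–Dirac operator of a `U(N)` lattice gauge field
`V` on `(ℤ/L)⁴` (defining representation).  For an axis `μ` and a height `s : ℤ/L` the *static slice
field* `S^μ_s V` has the antiperiodic pattern on its `μ`-links (`-1` on the seam `x_μ = -1`, `1`
elsewhere) and the other links of `V` read on the slice `x_μ = s`.  The colour-generic
combinatorial facts `staticIterate_swap_static` (`σ (S⁰_s (σ V)) = S^μ_s V` for `σ = (0 μ)`),
`staticIterate_comp` (four static slice operations land on the all-seams field `T`) and the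
geometric-mean root `staticIterate_root` are imported from the `U(3)` file.

* `staticIterate_axisBound_allN`: the time-direction static slice bound `D[V]^L ≤ ∏_s D[S⁰_s V]`
  for every field (hypothesis `hS`) holds in every direction, by the hypercubic covariance
  `det D_W[σV] = det D_W[V]` (`AxisSwap.det_wilsonDirac_swap`, any `L`, any `N`).
* `staticIterate_level3/2/1_allN`, `stub_staticIterateAllN`: the descent along the axes
  `3, 2, 1, 0`, taking `L`-th roots level by level, gives `D[V] ≤ D[T]`.
-/

namespace Summit.QuantumFields.QCD.Cruxes.FlatCellOptimal.Diamag

open Literature.MathematicalPhysics Literature.MathematicalPhysics.QuantumLattice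
  Literature.MathematicalPhysics.QuantumFieldTheory
open Matrix Complex
open Summit.QuantumFields.QCD.Theorems.UnquenchedChessboardBoundLine
open Summit.QuantumFields.QCD.Cruxes.WilsonQuarkStability.FreeTangentLandauChessboard

/-! ## The static slice bound in every direction -/

/-- **The `μ`-direction static slice bound** `D[V]^L ≤ ∏_s D[S^μ_s V]` (`U(N)` colours), from the
time-direction bound for every field (hypothesis `hS`) applied to the exchanged field `σV`,
`σ = (0 μ)`, the hypercubic covariance `det D_W[σV] = det D_W[V]` (twice) and
`σ (S⁰_s (σ V)) = S^μ_s V`. -/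
theorem staticIterate_axisBound_allN {N L : ℕ} [NeZero L]
    (hS : ∀ (V : GaugeConfig 4 L (Matrix.unitaryGroup (Fin N) ℂ)) (m : ℝ), -1 < m →
      ‖(wilsonDirac (unitaryFundamentalRep (Fin N) ℂ) V m 1).det‖ ^ L ≤
        ∏ s : ZMod L, ‖(wilsonDirac (unitaryFundamentalRep (Fin N) ℂ)
          (fun e : Edge 4 L => if e.2 = 0 then
              (if e.1 0 = -1 then (-1 : Matrix.unitaryGroup (Fin N) ℂ) else 1)
            else V (Function.update e.1 0 s, e.2)) m 1).det‖)
    (μ : Fin 4) (V : GaugeConfig 4 L (Matrix.unitaryGroup (Fin N) ℂ)) (m : ℝ) (hm : -1 < m) :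
    ‖(wilsonDirac (unitaryFundamentalRep (Fin N) ℂ) V m 1).det‖ ^ L ≤
      ∏ s : ZMod L, ‖(wilsonDirac (unitaryFundamentalRep (Fin N) ℂ)
        (fun e : Edge 4 L => if e.2 = μ then
            (if e.1 μ = -1 then (-1 : Matrix.unitaryGroup (Fin N) ℂ) else 1)
          else V (Function.update e.1 μ s, e.2)) m 1).det‖ := by
  have hρ : ∀ g : Matrix.unitaryGroup (Fin N) ℂ,
      unitaryFundamentalRep (Fin N) ℂ g ∈ Matrix.unitaryGroup (Fin N) ℂ :=
    unitaryFundamentalRep_mem_unitaryGroup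
  have h1 := hS (fun e : Edge 4 L =>
    V (e.1 ∘ ⇑(Equiv.swap (0 : Fin 4) μ), Equiv.swap (0 : Fin 4) μ e.2)) m hm
  have h2 : ‖(wilsonDirac (unitaryFundamentalRep (Fin N) ℂ) V m 1).det‖ ^ L =
      ‖(wilsonDirac (unitaryFundamentalRep (Fin N) ℂ) (fun e : Edge 4 L =>
        V (e.1 ∘ ⇑(Equiv.swap (0 : Fin 4) μ), Equiv.swap (0 : Fin 4) μ e.2)) m 1).det‖ ^ L :=
    congrArg (fun z : ℂ => ‖z‖ ^ L)
      (AxisSwap.det_wilsonDirac_swap (unitaryFundamentalRep (Fin N) ℂ) hρ V μ m).symm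
  refine (h2.trans_le h1).trans_eq (Finset.prod_congr rfl fun s _ => ?_)
  exact (congrArg (fun z : ℂ => ‖z‖)
    (AxisSwap.det_wilsonDirac_swap (unitaryFundamentalRep (Fin N) ℂ) hρ _ μ m)).symm.trans
      (congrArg (fun U : GaugeConfig 4 L (Matrix.unitaryGroup (Fin N) ℂ) =>
          ‖(wilsonDirac (unitaryFundamentalRep (Fin N) ℂ) U m 1).det‖)
        (staticIterate_swap_static (-1 : Matrix.unitaryGroup (Fin N) ℂ) 1 μ s V))

/-! ## The descent along the axes `3, 2, 1, 0` -/

/-- Level 3 (`U(N)` colours): every field of the form `S²_{s₂} (S¹_{s₁} (S⁰_{s₀} W))` is dominated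
by the all-seams trivial field (axis-`3` bound, whose factors are all `D[T]` by
`staticIterate_comp`). -/
theorem staticIterate_level3_allN {N L : ℕ} [NeZero L]
    (hS : ∀ (V : GaugeConfig 4 L (Matrix.unitaryGroup (Fin N) ℂ)) (m : ℝ), -1 < m →
      ‖(wilsonDirac (unitaryFundamentalRep (Fin N) ℂ) V m 1).det‖ ^ L ≤
        ∏ s : ZMod L, ‖(wilsonDirac (unitaryFundamentalRep (Fin N) ℂ)
          (fun e : Edge 4 L => if e.2 = 0 then
              (if e.1 0 = -1 then (-1 : Matrix.unitaryGroup (Fin N) ℂ) else 1)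
            else V (Function.update e.1 0 s, e.2)) m 1).det‖)
    (m : ℝ) (hm : -1 < m) (W : GaugeConfig 4 L (Matrix.unitaryGroup (Fin N) ℂ))
    (s₀ s₁ s₂ : ZMod L) :
    ‖(wilsonDirac (unitaryFundamentalRep (Fin N) ℂ)
      (fun e₂ : Edge 4 L => if e₂.2 = 2 then
          (if e₂.1 2 = -1 then (-1 : Matrix.unitaryGroup (Fin N) ℂ) else 1)
        else (fun e₁ : Edge 4 L => if e₁.2 = 1 then
            (if e₁.1 1 = -1 then (-1 : Matrix.unitaryGroup (Fin N) ℂ) else 1)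
          else (fun e₀ : Edge 4 L => if e₀.2 = 0 then
              (if e₀.1 0 = -1 then (-1 : Matrix.unitaryGroup (Fin N) ℂ) else 1)
            else W (Function.update e₀.1 0 s₀, e₀.2))
            (Function.update e₁.1 1 s₁, e₁.2))
          (Function.update e₂.1 2 s₂, e₂.2)) m 1).det‖ ≤
      ‖(wilsonDirac (unitaryFundamentalRep (Fin N) ℂ)
        (fun e : Edge 4 L => if e.1 e.2 = -1 then (-1 : Matrix.unitaryGroup (Fin N) ℂ) else 1)
        m 1).det‖ := by
  refine staticIterate_root (norm_nonneg _) (staticIterate_axisBound_allN hS 3 _ m hm)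
    (fun _ => norm_nonneg _) fun s₃ => le_of_eq ?_
  exact congrArg (fun U : GaugeConfig 4 L (Matrix.unitaryGroup (Fin N) ℂ) =>
      ‖(wilsonDirac (unitaryFundamentalRep (Fin N) ℂ) U m 1).det‖)
    (staticIterate_comp (-1 : Matrix.unitaryGroup (Fin N) ℂ) 1 s₀ s₁ s₂ s₃ W)

/-- Level 2 (`U(N)` colours): every field of the form `S¹_{s₁} (S⁰_{s₀} W)` is dominated by the
all-seams trivial field (axis-`2` bound and level 3). -/
theorem staticIterate_level2_allN {N L : ℕ} [NeZero L]
    (hS : ∀ (V : GaugeConfig 4 L (Matrix.unitaryGroup (Fin N) ℂ)) (m : ℝ), -1 < m →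
      ‖(wilsonDirac (unitaryFundamentalRep (Fin N) ℂ) V m 1).det‖ ^ L ≤
        ∏ s : ZMod L, ‖(wilsonDirac (unitaryFundamentalRep (Fin N) ℂ)
          (fun e : Edge 4 L => if e.2 = 0 then
              (if e.1 0 = -1 then (-1 : Matrix.unitaryGroup (Fin N) ℂ) else 1)
            else V (Function.update e.1 0 s, e.2)) m 1).det‖)
    (m : ℝ) (hm : -1 < m) (W : GaugeConfig 4 L (Matrix.unitaryGroup (Fin N) ℂ))
    (s₀ s₁ : ZMod L) :
    ‖(wilsonDirac (unitaryFundamentalRep (Fin N) ℂ)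
      (fun e₁ : Edge 4 L => if e₁.2 = 1 then
          (if e₁.1 1 = -1 then (-1 : Matrix.unitaryGroup (Fin N) ℂ) else 1)
        else (fun e₀ : Edge 4 L => if e₀.2 = 0 then
            (if e₀.1 0 = -1 then (-1 : Matrix.unitaryGroup (Fin N) ℂ) else 1)
          else W (Function.update e₀.1 0 s₀, e₀.2))
          (Function.update e₁.1 1 s₁, e₁.2)) m 1).det‖ ≤
      ‖(wilsonDirac (unitaryFundamentalRep (Fin N) ℂ)
        (fun e : Edge 4 L => if e.1 e.2 = -1 then (-1 : Matrix.unitaryGroup (Fin N) ℂ) else 1)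
        m 1).det‖ :=
  staticIterate_root (norm_nonneg _) (staticIterate_axisBound_allN hS 2 _ m hm)
    (fun _ => norm_nonneg _) fun s₂ => staticIterate_level3_allN hS m hm W s₀ s₁ s₂

/-- Level 1 (`U(N)` colours): every field of the form `S⁰_{s₀} W` is dominated by the all-seams
trivial field (axis-`1` bound and level 2). -/
theorem staticIterate_level1_allN {N L : ℕ} [NeZero L]
    (hS : ∀ (V : GaugeConfig 4 L (Matrix.unitaryGroup (Fin N) ℂ)) (m : ℝ), -1 < m →
      ‖(wilsonDirac (unitaryFundamentalRep (Fin N) ℂ) V m 1).det‖ ^ L ≤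
        ∏ s : ZMod L, ‖(wilsonDirac (unitaryFundamentalRep (Fin N) ℂ)
          (fun e : Edge 4 L => if e.2 = 0 then
              (if e.1 0 = -1 then (-1 : Matrix.unitaryGroup (Fin N) ℂ) else 1)
            else V (Function.update e.1 0 s, e.2)) m 1).det‖)
    (m : ℝ) (hm : -1 < m) (W : GaugeConfig 4 L (Matrix.unitaryGroup (Fin N) ℂ)) (s₀ : ZMod L) :
    ‖(wilsonDirac (unitaryFundamentalRep (Fin N) ℂ)
      (fun e₀ : Edge 4 L => if e₀.2 = 0 then
          (if e₀.1 0 = -1 then (-1 : Matrix.unitaryGroup (Fin N) ℂ) else 1)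
        else W (Function.update e₀.1 0 s₀, e₀.2)) m 1).det‖ ≤
      ‖(wilsonDirac (unitaryFundamentalRep (Fin N) ℂ)
        (fun e : Edge 4 L => if e.1 e.2 = -1 then (-1 : Matrix.unitaryGroup (Fin N) ℂ) else 1)
        m 1).det‖ :=
  staticIterate_root (norm_nonneg _) (staticIterate_axisBound_allN hS 1 _ m hm)
    (fun _ => norm_nonneg _) fun s₁ => staticIterate_level2_allN hS m hm W s₀ s₁

/-! ## The stub -/

/-- **Stub `stub_staticIterateAllN`.** From the time-direction static slice bound for every `U(N)`
field (hypothesis `hS`) and the hypercubic covariance of the Wilson determinant (any `L`, any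
`N`): applying the bound along the axes `0, 1, 2, 3` in turn makes every link static in every
direction, i.e. lands on the field with all links `1` except `-1` on the four seams `x_μ = -1`;
the `L`-th roots are taken level by level (`staticIterate_root`), so every `U(N)` field is
dominated by the all-seams trivial field: `‖det D_W[V, m]‖ ≤ ‖det D_W[T, m]‖` for `m > -1`. -/
theorem stub_staticIterateAllN :
    ∀ (N L : ℕ) [NeZero L],
      (∀ (V : GaugeConfig 4 L (Matrix.unitaryGroup (Fin N) ℂ)) (m : ℝ), -1 < m →
        ‖(wilsonDirac (unitaryFundamentalRep (Fin N) ℂ) V m 1).det‖ ^ L ≤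
          ∏ s : ZMod L, ‖(wilsonDirac (unitaryFundamentalRep (Fin N) ℂ)
            (fun e : Edge 4 L => if e.2 = 0 then (if e.1 0 = -1 then (-1 : Matrix.unitaryGroup (Fin N) ℂ) else 1)
              else V (Function.update e.1 0 s, e.2)) m 1).det‖) →
      ∀ (V : GaugeConfig 4 L (Matrix.unitaryGroup (Fin N) ℂ)) (m : ℝ), -1 < m →
        ‖(wilsonDirac (unitaryFundamentalRep (Fin N) ℂ) V m 1).det‖ ≤
          ‖(wilsonDirac (unitaryFundamentalRep (Fin N) ℂ)
            (fun e : Edge 4 L => if e.1 e.2 = -1 then (-1 : Matrix.unitaryGroup (Fin N) ℂ) else 1) m 1).det‖ := by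
  intro N L _ hS V m hm
  exact staticIterate_root (norm_nonneg _) (hS V m hm) (fun _ => norm_nonneg _)
    fun s₀ => staticIterate_level1_allN hS m hm V s₀

end Summit.QuantumFields.QCD.Cruxes.FlatCellOptimal.Diamag
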